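import Summits.RiemannHypothesis.RiemannHypothesis.Theorems.TiltedLandingLaw421R3RateChildCountE
import Summits.RiemannHypothesis.RiemannHypothesis.Theorems.TiltedLandingLaw421R3NestedSign
import Summits.RiemannHypothesis.RiemannHypothesis.Theorems.TiltedLandingLaw421R3Lens1PinningIsoB

/-! # RATE CHILD COUNT (F) — leaf L1 of R1a′: the upper child at a lowest zero of ANY MULTIPLICITY (lens-2 g4, stmt-RiemannHypothesis-33346)

(K) `exists_pow_cofactor`: a real entire `G` of order `< 2`, `G ≢ 0`, `G v = 0` (`Im v ≠ 0`) factors as `G = q^(k+1)·h` with `q = pairQ (Re v) (Im v)`,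
`h` real entire of order `< 2`, `h v ≠ 0` (iterate the tree's `RhW08.NestedSign.exists_cofactor`; termination by the finite analytic order of `G` at `v`).
★★★ `exists_child_mult` (analysis form) and ★★★ `farChild_of_mult` (frame form): at a lowest zero `v` of `f⁽ʲ⁾` of any multiplicity that is
`R/2`-isolated, separated (C′), LOW-CLEAR and has clean feet, in an `EngineHyps5 2` frame at a charged level, `f⁽ʲ⁺¹⁾` has an upper zero `w` with
`f⁽ʲ⁾ w ≠ 0` and `‖w − Re v‖ ≤ Im v` — via `f⁽ʲ⁺¹⁾ = q^k·H`, `H = 2(k+1)(z − Re v)h + q h′`, the Jensen sign of `h′/h` on the circle (tree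
`RhW08.NestedSign.im_mul_im_logDeriv_nonpos`) and module (E)'s `exists_upper_child_m`.  LAW `FarChildExistsLawSepMultJ` = R1a′ VERBATIM + LOW-CLEAR +
`CleanFeet` (NO simplicity binder, no `R/4`) and `farChildExistsLawSepMultJ_holds`.  Imports (E) + tree `…R3NestedSign`, `…R3Lens1PinningIsoB`;
in namespace `RhW08.ChildCount`; 0 `sorry`; axioms [propext, Classical.choice, Quot.sound].
Nothing here bears on the truth of RH; RH is not proved; 33346/33347 OPEN; checked ≠ proved. -/

noncomputable section

open Complex Metric Set
open scoped Real ComplexConjugate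
open Literature.Topology.PlaneTopology
open Literature.Analysis.Complex

namespace RhW08.ChildCount

open RhW08.IsolatedTilt (pairQ)

/-! ## §7 leaf L1: a MULTIPLE lowest zero (`f⁽ʲ⁾ = q^(k+1)·h`): the count of modules (D)/(E) at an `m`-fold pair gives R1a′
WITHOUT the simplicity binder (binders LOW-CLEAR + `CleanFeet`) -/

open Summit.RiemannHypothesis.RiemannHypothesis.Theorems.Splittings.JensenWindow (RealEntireLt2)
open RhIdea6.G17.W07C7 (NLEventOf)

/-- (K) **MULTIPLICITY EXTRACTION.** `G` real entire of order `< 2`, `G ≢ 0`, `G v = 0` with `Im v ≠ 0` ⇒ `G = q^(k+1)·h` (`q = pairQ (Re v) (Im v)`)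
with `h` real entire of order `< 2` and `h v ≠ 0`.  (Iterate the tree's `RhW08.NestedSign.exists_cofactor`; the iteration stops because each
pair removed lowers the finite analytic order of `G` at `v`.) -/
theorem exists_pow_cofactor {G : ℂ → ℂ} (hG : RealEntireLt2 G) {v : ℂ} (hv : G v = 0) (hv0 : v.im ≠ 0) {y : ℂ} (hy : G y ≠ 0) :
    ∃ k : ℕ, ∃ h : ℂ → ℂ, Differentiable ℂ h ∧ (∃ ρ C : ℝ, 0 ≤ ρ ∧ ρ < 2 ∧ ∀ z, ‖h z‖ ≤ C * Real.exp (‖z‖ ^ ρ)) ∧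
      (∀ x : ℝ, (h x).im = 0) ∧ (∀ z, G z = pairQ v.re v.im z ^ (k + 1) * h z) ∧ h v ≠ 0 := by
  classical
  set q : ℂ → ℂ := pairQ v.re v.im with hq
  -- the data carried along the iteration
  set P : ℕ → Prop := fun n => ∃ h : ℂ → ℂ, Differentiable ℂ h ∧
      (∃ ρ C : ℝ, 0 ≤ ρ ∧ ρ < 2 ∧ ∀ z, ‖h z‖ ≤ C * Real.exp (‖z‖ ^ ρ)) ∧ (∀ x : ℝ, (h x).im = 0) ∧
      ∀ z, G z = q z ^ n * h z with hP
  have hP0 : P 0 := ⟨G, hG.diff, hG.growth, hG.real, fun z => by rw [pow_zero, one_mul]⟩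
  -- analytic orders at `v`
  have hqd : Differentiable ℂ q := by rw [hq]; unfold pairQ; fun_prop
  have hqan : AnalyticAt ℂ q v := (hqd.analyticAt v)
  have hqv : q v = 0 := by rw [hq, RhW08.IsolatedTilt.pairQ_eq_mul, Complex.re_add_im, sub_self, zero_mul]
  have hq1 : (1 : ℕ∞) ≤ analyticOrderAt q v := Order.one_le_iff_ne_zero.2 (analyticOrderAt_ne_zero.2 ⟨hqan, hqv⟩)
  have hGan : AnalyticOnNhd ℂ G Set.univ := Complex.analyticOnNhd_univ_iff_differentiable.2 hG.diff
  have hfin : analyticOrderAt G v ≠ ⊤ :=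
    AnalyticOnNhd.analyticOrderAt_ne_top_of_isPreconnected hGan isPreconnected_univ (Set.mem_univ y) (Set.mem_univ v)
      (by rw [analyticOrderAt_eq_zero.2 (Or.inr hy)]; exact ENat.zero_ne_top)
  have hA : ∀ n : ℕ, P n → (n : ℕ∞) ≤ analyticOrderAt G v := by
    rintro n ⟨h, hh, -, -, hfac⟩
    have e : G = q ^ n * h := funext fun z => by rw [hfac z]; rfl
    rw [e, analyticOrderAt_mul (hqan.pow n) (hh.analyticAt v), analyticOrderAt_pow hqan]
    calc (n : ℕ∞) = n • (1 : ℕ∞) := by rw [nsmul_one]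
      _ ≤ n • analyticOrderAt q v := nsmul_le_nsmul_right hq1 n
      _ ≤ n • analyticOrderAt q v + analyticOrderAt h v := le_self_add
  -- the iteration cannot go on for ever
  obtain ⟨N, hN⟩ := ENat.ne_top_iff_exists.1 hfin
  have hnot : ∃ n, ¬ P n := ⟨N + 1, fun hPn => by
    have := hA (N + 1) hPn; rw [← hN] at this
    exact absurd (ENat.coe_le_coe.1 this) (by omega)⟩
  set n₀ := Nat.find hnot with hn₀
  have hn₀not : ¬ P n₀ := Nat.find_spec hnot
  have hstep : ∀ n (h : ℂ → ℂ), Differentiable ℂ h → (∃ ρ C : ℝ, 0 ≤ ρ ∧ ρ < 2 ∧ ∀ z, ‖h z‖ ≤ C * Real.exp (‖z‖ ^ ρ)) →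
      (∀ x : ℝ, (h x).im = 0) → (∀ z, G z = q z ^ n * h z) → h v = 0 → P (n + 1) := by
    intro n h hh hgr hreal hfac hhv
    obtain ⟨h', hh', hgr', hreal', hfac'⟩ :=
      RhW08.NestedSign.exists_cofactor (G := h) ⟨hh, hgr, hreal⟩ hhv hv0
    exact ⟨h', hh', hgr', hreal', fun z => by rw [hfac z, hfac' z, pow_succ]; ring⟩
  have hn₀pos : 0 < n₀ := by
    rw [hn₀, Nat.find_pos]; exact fun h => h hP0
  obtain ⟨k₀, hk₀⟩ : ∃ k₀, n₀ = k₀ + 1 := ⟨n₀ - 1, by omega⟩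
  have hPk₀ : P k₀ := by
    by_contra hc
    have := Nat.find_min hnot (show k₀ < n₀ by omega)
    exact this hc
  obtain ⟨h, hh, hgr, hreal, hfac⟩ := hPk₀
  have hhv : h v ≠ 0 := fun h0 => hn₀not (hk₀ ▸ hstep k₀ h hh hgr hreal hfac h0)
  -- `k₀ ≥ 1` because `G v = 0`
  obtain ⟨k, hk⟩ : ∃ k, k₀ = k + 1 := by
    rcases Nat.eq_zero_or_pos k₀ with h0 | hpos
    · exfalso; apply hhv
      have := hfac v; rw [h0, pow_zero, one_mul] at this; rw [← this]; exact hv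
    · exact ⟨k₀ - 1, by omega⟩
  exact ⟨k, h, hh, hgr, hreal, fun z => by rw [hfac z, hk], hhv⟩

set_option maxHeartbeats 1600000 in
/-- ★★★ (K) **THE UPPER CHILD AT A MULTIPLE (OR SIMPLE) ZERO, analysis form.**  `f` real entire of order `< 2`; `v` an upper zero of `f⁽ʲ⁾` of ANY
multiplicity, `Im v ≤ R/2`, `R/2`-isolated, separated from the taller zoo (C′) and LOW-CLEAR (every other upper zero `z` with `Im z ≤ Im v` has its
closed Jensen disc disjoint from `v`'s); no `NLEventOf f j` on the closed diameter; clean feet.  Then `f⁽ʲ⁺¹⁾` has an upper zero `w` with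
`f⁽ʲ⁾ w ≠ 0` in the closed Jensen disc.  PROOF: `f⁽ʲ⁾ = q^(k+1)·h` (`exists_pow_cofactor`), `f⁽ʲ⁺¹⁾ = q^k·H`, `H = 2(k+1)(z − Re v)h + q h′`;
`h` is zero-free on the closed disc and has the Jensen sign on the circle (every other Jensen disc is disjoint from `v`'s: tree
`RhW08.NestedSign.im_mul_im_logDeriv_nonpos`); «no NL event» for `f⁽ʲ⁾` is `G₁·H′ < 0` at the real zeros of `H` (`G₁ = q·h`;
`f⁽ʲ⁾·f⁽ʲ⁺²⁾ = q^(2k)·G₁·H′` there); module (E)'s `exists_upper_child_m`. -/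
theorem exists_child_mult {f : ℂ → ℂ} (hf : RealEntireLt2 f) (j : ℕ) {v : ℂ} {R : ℝ}
    (hv : iteratedDeriv j f v = 0) (hv0 : 0 < v.im) (hvR : v.im ≤ R / 2)
    (hiso : ∀ z : ℂ, iteratedDeriv j f z = 0 → |z.re - v.re| < R / 2 → z = v ∨ z = conj v)
    (hsep : ∀ z : ℂ, iteratedDeriv j f z = 0 → v.im < z.im → v.im + z.im < |v.re - z.re|)
    (hlowclear : ∀ z : ℂ, iteratedDeriv j f z = 0 → 0 < z.im → z.im ≤ v.im → z ≠ v → v.im + z.im < |v.re - z.re|)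
    (hnoNL : ∀ x : ℝ, |x - v.re| ≤ v.im → ¬ NLEventOf f j x) (hclean : RhW08.Lens1PinningIso.CleanFeet f j v) :
    ∃ w : ℂ, iteratedDeriv (j + 1) f w = 0 ∧ iteratedDeriv j f w ≠ 0 ∧ 0 < w.im ∧ ‖w - (v.re : ℂ)‖ ≤ v.im := by
  classical
  have hG : RealEntireLt2 (iteratedDeriv j f) := RhW08.WindowLoss.realEntireLt2_iteratedDeriv hf j
  set G := iteratedDeriv j f with hGdef
  have hG1 : iteratedDeriv (j + 1) f = deriv G := by rw [iteratedDeriv_succ]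
  have hG2 : iteratedDeriv (j + 2) f = deriv (deriv G) := by
    rw [show j + 2 = j + 1 + 1 from rfl, iteratedDeriv_succ, iteratedDeriv_succ]
  -- feet in the two spellings
  have efoot1 : (((v.re + v.im : ℝ)) : ℂ) = (v.re : ℂ) + v.im := by push_cast; ring
  have efoot2 : (((v.re - v.im : ℝ)) : ℂ) = (v.re : ℂ) - v.im := by push_cast; ring
  obtain ⟨hcl1, hcl2, hcl3, hcl4⟩ := hclean
  rw [efoot2] at hcl1 hcl3
  rw [efoot1] at hcl2 hcl4
  -- multiplicity extraction
  obtain ⟨k, h, hhd, ⟨ρ, C, hρ0, hρ, hgr⟩, hreal, hfac, hhv⟩ := exists_pow_cofactor hG hv hv0.ne' hcl2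
  set q : ℂ → ℂ := pairQ v.re v.im with hqdef
  set a : ℝ := v.re with ha
  set b : ℝ := v.im with hb
  set G₁ : ℂ → ℂ := fun z => q z * h z with hG₁
  set H : ℂ → ℂ := fun z => 2 * ((k + 1 : ℕ) : ℂ) * (z - a) * h z + q z * deriv h z with hH
  have hh'd : Differentiable ℂ (deriv h) := by
    have := differentiable_iteratedDeriv_of_entire hhd 1; rwa [iteratedDeriv_one] at this
  have hqd : Differentiable ℂ q := by rw [hqdef]; unfold pairQ; fun_prop
  have hqx : ∀ x : ℝ, q (x : ℂ) = ((((x - a) ^ 2 + b ^ 2 : ℝ)) : ℂ) := by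
    intro x; rw [hqdef]; simp only [pairQ]; push_cast; ring
  have hQpos : ∀ x : ℝ, 0 < (x - a) ^ 2 + b ^ 2 := fun x => by positivity
  -- `G′ = q^k · H`
  have hderivG : deriv G = fun z => q z ^ k * H z := by
    funext z
    have e : G = fun w => q w ^ (k + 1) * h w := funext hfac
    rw [e]
    have hq' : HasDerivAt q (2 * (z - a)) z := RhW07.Law421.SuccessorCertificate.hasDerivAt_quadP a b z
    have := ((hq'.pow (k + 1)).mul (hhd z).hasDerivAt).deriv
    rw [show (fun w => q w ^ (k + 1) * h w) = (q ^ (k + 1) * h) from rfl, this, hH]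
    simp only [Nat.add_sub_cancel, Pi.pow_apply]
    push_cast
    ring
  have hh'real : ∀ x : ℝ, (deriv h x).im = 0 := fun x => by
    have := im_iteratedDeriv_ofReal hhd hreal 1 x; rwa [iteratedDeriv_one] at this
  have ehx : ∀ x : ℝ, h x = (((h x).re : ℝ) : ℂ) := fun x => Complex.ext (by rw [ofReal_re]) (by rw [ofReal_im]; exact hreal x)
  have eh'x : ∀ x : ℝ, deriv h x = (((deriv h x).re : ℝ) : ℂ) := fun x =>
    Complex.ext (by rw [ofReal_re]) (by rw [ofReal_im]; exact hh'real x)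
  have hHx : ∀ x : ℝ, H x = (((2 * (k + 1) * (x - a) * (h x).re + ((x - a) ^ 2 + b ^ 2) * (deriv h x).re : ℝ)) : ℂ) := by
    intro x; simp only [hH]; rw [hqx]; nth_rw 1 [ehx x]; nth_rw 1 [eh'x x]; push_cast; ring
  have hHreal : ∀ x : ℝ, (H x).im = 0 := fun x => by rw [hHx, ofReal_im]
  have hG₁x : ∀ x : ℝ, G₁ x = (((((x - a) ^ 2 + b ^ 2) * (h x).re : ℝ)) : ℂ) := by
    intro x; simp only [hG₁]; rw [hqx]; nth_rw 1 [ehx x]; push_cast; ring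
  have hG₁real : ∀ x : ℝ, (G₁ x).im = 0 := fun x => by rw [hG₁x, ofReal_im]
  have hG₁d : Differentiable ℂ G₁ := hqd.mul hhd
  -- the cofactor does not vanish at `v̄` either
  have hhvbar : h (conj v) ≠ 0 := by rw [apply_conj_eq_conj hhd hreal, map_ne_zero]; exact hhv
  have hGz_of_h : ∀ z, h z = 0 → G z = 0 := fun z hz => by rw [hfac z, hz, mul_zero]
  -- geometry: an upper zero `z ≠ v` of `G` is never in the closed disc; more: its disc is disjoint from `v`'s
  have hdisj : ∀ z : ℂ, G z = 0 → 0 < z.im → z ≠ v → b + z.im < |a - z.re| := by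
    intro z hz hzpos hzv
    rcases le_or_gt z.im b with hle | hgt
    · exact hlowclear z hz hzpos hle hzv
    · exact hsep z hz hgt
  have hreabs : ∀ z : ℂ, |z.re - a| ≤ ‖z - (a : ℂ)‖ := fun z => by
    have := Complex.abs_re_le_norm (z - a); simpa only [sub_re, ofReal_re] using this
  have hdisj' : ∀ z : ℂ, G z = 0 → z.im ≠ 0 → z ≠ v → z ≠ conj v → b + |z.im| < |z.re - a| := by
    intro z hz hzim hzv hzv'
    rw [abs_sub_comm z.re a]
    rcases lt_or_gt_of_ne hzim with hneg | hpos
    · have hz' : G (conj z) = 0 := by rw [apply_conj_eq_conj hG.diff hG.real, hz, map_zero]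
      have hne : conj z ≠ v := fun e => hzv' (by rw [← e, Complex.conj_conj])
      have h1 := hdisj (conj z) hz' (by rw [conj_im]; linarith) hne
      rw [conj_im, conj_re] at h1
      rw [abs_of_neg hneg]
      linarith
    · have h1 := hdisj z hz hpos hzv
      rw [abs_of_pos hpos]
      exact h1
  -- `h` is zero-free on the closed Jensen disc
  have hh0 : ∀ z ∈ closedBall (a : ℂ) b, h z ≠ 0 := by
    intro z hz h0
    rw [mem_closedBall, dist_eq_norm] at hz
    have hGz := hGz_of_h z h0
    have hzv : z ≠ v := fun e => hhv (e ▸ h0)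
    have hzv' : z ≠ conj v := fun e => hhvbar (e ▸ h0)
    by_cases hzim : z.im = 0
    · -- a real zero in the closed diameter: isolation (or clean feet at the two endpoints)
      have hzx : z = ((z.re : ℝ) : ℂ) := Complex.ext (by rw [ofReal_re]) (by rw [ofReal_im, hzim])
      have hre : |z.re - a| ≤ b := (hreabs z).trans hz
      rcases lt_or_eq_of_le (hre.trans hvR) with hlt | heq
      · rcases hiso z hGz hlt with e | e
        · exact hzv e
        · exact hzv' e
      · have hba : |z.re - a| = b := le_antisymm hre (by rw [heq]; exact hvR)
        rcases (abs_eq hv0.le).1 hba with e | e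
        · have ez : z = (a : ℂ) + b := by
            rw [hzx, show z.re = a + b by linarith]; push_cast; ring
          exact hcl2 (by rw [← ez]; exact hGz)
        · have ez : z = (a : ℂ) - b := by
            rw [hzx, show z.re = a - b by linarith]; push_cast; ring
          exact hcl1 (by rw [← ez]; exact hGz)
    · have h1 := hdisj' z hGz hzim hzv hzv'
      have h2 := (hreabs z).trans hz
      have h3 : 0 ≤ |z.im| := abs_nonneg _
      linarith
  -- the Jensen sign of `h′/h` on the whole circle
  have hsign : ∀ z : ℂ, ‖z - (a : ℂ)‖ = b → z.im * (deriv h z / h z).im ≤ 0 := by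
    intro z hz
    have hzball : z ∈ closedBall (a : ℂ) b := by rw [mem_closedBall, dist_eq_norm]; exact hz.le
    refine RhW08.NestedSign.im_mul_im_logDeriv_nonpos hhd hρ0 hρ hgr hreal (hh0 z hzball) fun a' ha' => ?_
    have hGa : G a' = 0 := hGz_of_h a' ha'
    have hav : a' ≠ v := fun e => hhv (e ▸ ha')
    have hav' : a' ≠ conj v := fun e => hhvbar (e ▸ ha')
    by_cases haim : a'.im = 0
    · -- a real zero of `h`: `z ≠ a'` because `h z ≠ 0`
      rw [haim, abs_zero]
      have hax : a' = ((a'.re : ℝ) : ℂ) := Complex.ext (by rw [ofReal_re]) (by rw [ofReal_im, haim])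
      have hne : z ≠ (a'.re : ℂ) := fun e => hh0 z hzball (by rw [e, ← hax]; exact ha')
      exact norm_pos_iff.2 (sub_ne_zero.2 hne)
    · have h1 := hdisj' a' hGa haim hav hav'
      -- `‖z − Re a'‖ ≥ |Re a' − a| − b > |Im a'|`
      have h3 : |a'.re - a| - b ≤ ‖z - (a'.re : ℂ)‖ := by
        have h4 : |z.re - a'.re| ≤ ‖z - (a'.re : ℂ)‖ := by
          have := Complex.abs_re_le_norm (z - a'.re); simpa only [sub_re, ofReal_re] using this
        have h5 : |z.re - a| ≤ b := (hreabs z).trans hz.le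
        have h6 := abs_sub_le a'.re z.re a
        rw [abs_sub_comm a'.re z.re] at h6
        linarith
      linarith
  -- no NL event on the closed diameter ⇒ `G₁·H′ < 0` at the real zeros of `H`
  have hnoNL' : ∀ x : ℝ, |x - a| ≤ b → (H x).re = 0 → (G₁ x).re * (deriv H x).re < 0 := by
    intro x hx hH0
    have hxball : (x : ℂ) ∈ closedBall (a : ℂ) b := by
      rw [mem_closedBall, dist_eq_norm, ← ofReal_sub, Complex.norm_real, Real.norm_eq_abs]; exact hx
    have hHx0 : H x = 0 := Complex.ext (by rw [zero_re]; exact hH0) (by rw [zero_im]; exact hHreal x)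
    have hQ := hQpos x
    set Q : ℝ := (x - a) ^ 2 + b ^ 2 with hQdef
    have hhx : (h x).re ≠ 0 := fun h0 => hh0 _ hxball (by rw [ehx x, h0]; simp)
    -- values of `G`, `G′`, `G″` at `x`
    have eG : G x = (((Q ^ (k + 1) * (h x).re : ℝ)) : ℂ) := by
      rw [hfac, hqx, ← hQdef]; nth_rw 1 [ehx x]; push_cast; ring
    have eG' : deriv G x = 0 := by rw [hderivG]; simp only []; rw [hHx0, mul_zero]
    have hHd : Differentiable ℂ H := by
      simp only [hH]
      exact (((differentiable_const _).mul (differentiable_id.sub (differentiable_const _))).mul hhd).add (hqd.mul hh'd)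
    have eG'' : deriv (deriv G) x = (((Q ^ k : ℝ)) : ℂ) * deriv H x := by
      rw [hderivG]
      have := (((hqd.pow k) x).hasDerivAt.mul (hHd x).hasDerivAt).deriv
      rw [show (fun z => q z ^ k * H z) = (q ^ k * H) from rfl, this, hHx0, mul_zero, zero_add]
      rw [show (q ^ k) (x : ℂ) = q x ^ k from rfl, hqx, ← hQdef]; push_cast; ring
    have hn := hnoNL x hx
    unfold NLEventOf at hn
    rw [← hGdef, hG1, hG2] at hn
    have h1 : (deriv G x).re = 0 := by rw [eG', zero_re]
    have hGx : (G x).re ≠ 0 := by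
      rw [eG, ofReal_re]; exact mul_ne_zero (pow_ne_zero _ hQ.ne') hhx
    have hlt : (G x).re * (deriv (deriv G) x).re < 0 := by
      by_contra hge; push Not at hge; exact hn ⟨h1, hGx, hge⟩
    rw [eG, eG'', ofReal_re, re_ofReal_mul] at hlt
    have eG₁ : (G₁ x).re = Q * (h x).re := by rw [hG₁x, ofReal_re]
    rw [eG₁]
    have hQk : 0 < Q ^ k := pow_pos hQ k
    have key : Q ^ (k + 1) * (h x).re * (Q ^ k * (deriv H x).re) = (Q ^ k * Q ^ k) * (Q * (h x).re * (deriv H x).re) := by ring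
    rw [key] at hlt
    by_contra hge
    push Not at hge
    have := mul_nonneg (mul_pos hQk hQk).le hge
    linarith
  -- `H ≠ 0` at the feet (`f⁽ʲ⁺¹⁾ = q^k·H` there)
  have hHfoot : ∀ u : ℂ, deriv G u ≠ 0 → H u ≠ 0 := by
    intro u hu hH0; apply hu; rw [hderivG]; simp only []; rw [hH0, mul_zero]
  have hfeet' : H ((a : ℂ) + b) ≠ 0 ∧ H ((a : ℂ) - b) ≠ 0 :=
    ⟨hHfoot _ (by rw [← hG1]; exact hcl4), hHfoot _ (by rw [← hG1]; exact hcl3)⟩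
  -- module (E)
  obtain ⟨w, hw1, hw2, hw3, hw4⟩ := exists_upper_child_m (m := k + 1) (Nat.succ_pos k) hv0 (by linarith : b < 2 * b)
    hG₁d hhd (fun z => rfl) (fun z => rfl) hG₁real hreal hh0 hsign hnoNL' hfeet'
  refine ⟨w, ?_, ?_, hw3, hw4⟩
  · rw [hG1, hderivG]; show q w ^ k * H w = 0; rw [show H w = 0 from hw1, mul_zero]
  · intro hGw
    apply hw2
    rw [hfac w, pow_succ] at hGw
    simp only [hG₁]
    rcases mul_eq_zero.1 hGw with h0 | h0
    · rcases mul_eq_zero.1 h0 with h00 | h00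
      · rw [pow_eq_zero_iff'] at h00; rw [h00.1, zero_mul]
      · rw [h00, zero_mul]
    · rw [h0, mul_zero]

open RhIdea6.G17.W07C7 RhIdea6.G17.W07C7.Rev6 RhIdea6.G18.W07C8.Law421BirthS RhIdea6.G19.W07C11.Seam RhIdea6.G20.W07C12.Frac
  RhIdea6.G20.W07C12.StColP RhW07.C12.FieldSplit RhW08.Round1 RhW08.StSwap RhW08.Round2 RhW08.QuadW RhW08.SealSwapQ in
open RhW08.SealSwap (PBot) in
/-- ★★★ (K) **R1a′ AT A LOWEST ZERO OF ANY MULTIPLICITY** (leaf L1 discharged; binders LOW-CLEAR + clean feet).  In an `EngineHyps5 2` frame, at a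
CHARGED level `j`, for `v` lowest, isolated (`R/2`), separated (C′), LOW-CLEAR, with clean feet: R1a′'s conclusion holds — whatever the
multiplicity of `v`. -/
theorem farChild_of_mult {η : ℝ} {f : ℂ → ℂ} {x₀ s hmax R Hs : ℝ} {B : ℕ} (hE : EngineHyps5 2 η f x₀ s hmax R Hs B)
    {j : ℕ} {v : ℂ} (hC : Charged (PTrkSQ PBot) StTrkDQ ReadyR2 η f x₀ s hmax R Hs B j)
    (hlow : IsLowest StTrkDQ η f x₀ s hmax R Hs B j v)
    (hiso : ∀ z : ℂ, iteratedDeriv j f z = 0 → |z.re - v.re| < R / 2 → z = v ∨ z = conj v)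
    (hsep : ∀ z : ℂ, iteratedDeriv j f z = 0 → v.im < z.im → v.im + z.im < |v.re - z.re|)
    (hlowclear : ∀ z : ℂ, iteratedDeriv j f z = 0 → 0 < z.im → z.im ≤ v.im → z ≠ v → v.im + z.im < |v.re - z.re|)
    (hclean : RhW08.Lens1PinningIso.CleanFeet f j v) :
    ∃ w : ℂ, iteratedDeriv (j + 1) f w = 0 ∧ iteratedDeriv j f w ≠ 0 ∧ 0 < w.im ∧ ‖w - (v.re : ℂ)‖ ≤ |v.im| := by
  have hf : RealEntireLt2 f := RhW08.Column.realEntireLt2_of_hyps hE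
  have hv : iteratedDeriv j f v = 0 := hlow.1.2.1
  have hv0 : 0 < v.im := hlow.1.2.2.1
  have hvHs : v.im ≤ Hs := hlow.1.2.2.2.2
  have hbud : (max (|v.re - x₀| - R / 2) 0) ^ 2 + (j : ℝ) * v.im ^ 2 ≤ (j : ℝ) * Hs ^ 2 := hlow.1.2.2.2.1
  obtain ⟨-, -, -, hs, hsh, hhR, -, hHs0, -, hHsR, -⟩ := hE
  have hR : 0 < R := by linarith
  -- the closed diameter of `v` lies inside the window of `TiltReady` at level `j`
  have hwin : ∀ x : ℝ, |x - v.re| ≤ v.im → |x - x₀| < ((j : ℝ) + 3) * R / 2 := by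
    intro x hx
    have hm0 : 0 ≤ max (|v.re - x₀| - R / 2) 0 := le_max_right _ _
    have hm1 : |v.re - x₀| - R / 2 ≤ max (|v.re - x₀| - R / 2) 0 := le_max_left _ _
    have hj : (0 : ℝ) ≤ j := Nat.cast_nonneg j
    have hm2 : (max (|v.re - x₀| - R / 2) 0) ^ 2 ≤ (j : ℝ) * (R / 2) ^ 2 := by
      have h1 : (max (|v.re - x₀| - R / 2) 0) ^ 2 ≤ (j : ℝ) * Hs ^ 2 := by nlinarith [sq_nonneg v.im]
      have h2 : Hs ^ 2 ≤ (R / 2) ^ 2 := by nlinarith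
      nlinarith
    have hm3 : max (|v.re - x₀| - R / 2) 0 ≤ (j : ℝ) * (R / 2) := by
      have hj2 : (j : ℝ) ≤ (j : ℝ) ^ 2 := by
        rcases Nat.eq_zero_or_pos j with h0 | hpos
        · simp [h0]
        · have : (1 : ℝ) ≤ j := by exact_mod_cast hpos
          nlinarith
      have h4 : (max (|v.re - x₀| - R / 2) 0) ^ 2 ≤ ((j : ℝ) * (R / 2)) ^ 2 := by nlinarith [sq_nonneg R]
      exact (pow_le_pow_iff_left₀ hm0 (by positivity) two_ne_zero).1 h4
    have h5 := abs_sub_le x v.re x₀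
    nlinarith
  -- `Charged` ⇒ `¬ ReadyR2` at level `j` ⇒ no NL event of level `j` in the window
  have hnoNL : ∀ x : ℝ, |x - v.re| ≤ v.im → ¬ NLEventOf f j x := by
    obtain ⟨v', -, hnr, -⟩ := hC
    intro x hx hNL
    apply hnr
    unfold ReadyR2 CumReady WinOrTilt TiltReady
    exact ⟨j, le_rfl, Or.inr ⟨x, hwin x hx, hNL⟩⟩
  obtain ⟨w, h1, h2, h3, h4⟩ := exists_child_mult hf j hv hv0 (by linarith) hiso hsep hlowclear hnoNL hclean
  exact ⟨w, h1, h2, h3, by rwa [abs_of_pos hv0]⟩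

open RhIdea6.G17.W07C7 RhIdea6.G17.W07C7.Rev6 RhIdea6.G18.W07C8.Law421BirthS RhIdea6.G19.W07C11.Seam RhIdea6.G20.W07C12.Frac
  RhIdea6.G20.W07C12.StColP RhW07.C12.FieldSplit RhW08.Round1 RhW08.StSwap RhW08.Round2 RhW08.QuadW RhW08.SealSwapQ in
open RhW08.SealSwap (PBot) in
/-- (LAW R1a′ᴹ — R1a′ `FarChildExistsLawSep` VERBATIM with two appended binders: LOW-CLEAR and `CleanFeet`; NO simplicity, no `R/4`.)  Together with
R1a′ᴶ (`FarChildExistsLawSepSimpleJ`: SIMPLE + LOW-CLEAR) the honest residual of R1a′ is: L2ᴶ low-clearness (method), or the corner «`v` multiple AND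
a foot of `v` degenerate» (codimension ≥ 3). -/
def FarChildExistsLawSepMultJ : Prop :=
  ∀ (η : ℝ) (f : ℂ → ℂ) (x₀ s hmax R Hs : ℝ) (B : ℕ), EngineHyps5 2 η f x₀ s hmax R Hs B → ∀ (j : ℕ) (v : ℂ),
    Charged (PTrkSQ PBot) StTrkDQ ReadyR2 η f x₀ s hmax R Hs B j → IsLowest StTrkDQ η f x₀ s hmax R Hs B j v →
    (∀ z : ℂ, iteratedDeriv j f z = 0 → |z.re - v.re| < R / 2 → z = v ∨ z = conj v) →
    (∀ z : ℂ, iteratedDeriv j f z = 0 → v.im < z.im → v.im + z.im < |v.re - z.re|) →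
    (∀ z : ℂ, iteratedDeriv j f z = 0 → 0 < z.im → z.im ≤ v.im → z ≠ v → v.im + z.im < |v.re - z.re|) →
    RhW08.Lens1PinningIso.CleanFeet f j v →
    ∃ w : ℂ, iteratedDeriv (j + 1) f w = 0 ∧ iteratedDeriv j f w ≠ 0 ∧ 0 < w.im ∧ ‖w - (v.re : ℂ)‖ ≤ |v.im|

/-- ★★★ (K) **R1a′ᴹ HOLDS** (leaf L1: no simplicity binder). -/
theorem farChildExistsLawSepMultJ_holds : FarChildExistsLawSepMultJ :=
  fun _ _ _ _ _ _ _ _ hE _ _ hC hlow hiso hsep hlc hclean => farChild_of_mult hE hC hlow hiso hsep hlc hclean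

end RhW08.ChildCount
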